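import Summits.NavierStokesRegularity.FunctionalMining.NoGo.TopEigHeatIsoTop
import Summits.NavierStokesRegularity.FunctionalMining.NoGo.TopEigAmplitudeFloorLow
import HarnessLib

/-!
# FunctionalMining / NoGo — K57b: ISO-TOP and EXACT ONCE ⇒ EXACT ALWAYS from ANY exponent `q > 1`
# (an exact (F2) witness at any real `q > 1` has a CONSTANT top strain eigenvalue)

HONEST FRAMING. Search for candidate a priori estimates; no regularity claim. Nothing about
Navier–Stokes is proved or asserted in this file. Cell `pub-nsfunc`, no-go seat (gen 53, touch 2).
Static calculus of smooth fields on the flat torus.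

CONTEXT. K53 (`NoGo/TopEigHeatIsoTop`) proved ISO-TOP — `heatDissipation Φ_q v ≤ 0` for a smooth
divergence-free `v` (`card d = 3`) forces `λ₁(S_v) ≡ const` — and EXACT ONCE ⇒ EXACT ALWAYS for real
exponents `q ≥ 2` only, because its amplitude input LEMMA AF was kernel for `q ≥ 2` only («NOT here:
`1 < q < 2`»). K57a (`NoGo/TopEigAmplitudeFloorLow`) puts LEMMA AF on the whole range `q > 1` (Fatou
form, integrable floor integrand). This file draws the consequences on the whole range of the node.

CONTENT (`λ₁ = torusStrainTopEig v`; `card d = 3` inside the hypotheses, the cellʼs convention):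
* § 1 **`gradient_topEig_eq_zero_ae_of_one_lt`**: `heatDissipation Φ_q v ≤ 0` at ANY real `q > 1` ⇒
  `∇λ₁ = 0` a.e. (the non-negative integrable floor integrand has integral `≤ 0`; Rademacher points
  with `λ₁ > 0`, Fermat at the zeros — K53ʼs `IsoTop.torusFderiv_eq_zero_of_forall_le`);
  **`torusStrainTopEig_eq_of_heatDissipation_nonpos_of_one_lt` (ISO-TOP, every real `q > 1`)** via
  K53ʼs Liouville step `IsoTop.eq_of_gradient_eq_zero_ae`; the frozen value `Φ_p(v) = m^p`;
  contrapositives: a NON-CONSTANT `λ₁`, or a strain zero with `Φ_q > 0`, pays a POSITIVE heat price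
  at EVERY real `q > 1` (`heatDissipation_topEigMoment_pos_of_ne_of_one_lt`,
  `…_pos_of_topEig_eq_zero_of_one_lt`).
* § 2 (`T³ = UnitAddTorus (Fin 3)`) **`heatDissipation_topEigMoment_eq_zero_of_exact_of_one_lt`
  (EXACT ONCE ⇒ EXACT ALWAYS from ANY `q₀ > 1`)** and the portrait
  `exact_witness_isoTop_portrait_of_one_lt`: reduction to K53 § 4 at the exponent `2` — a frozen top
  exact at `q₀` is exact at `2` (`heatDissipation_two_nonpos_of_exact_of_one_lt`: Danskin on the
  frozen top, `heatDissipation Φ_p v = −p m^{p−1}∫μ`, one sign for all exponents). Sharpens K50 (R8)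
  on the whole range: the exact-exponent set of a design is `∅` or ALL of `(1, ∞)`.

MEANING FOR (F2) (design rule (R11) on the whole range, records only). An exact witness against
L-λ(q) at ANY real `q > 1` lives in the rigid class `{λ₁(S_v) ≡ const}` and is universal (exact at
every `q > 1`: all of K47–K53 apply to it at once); every design with a non-constant top strain
eigenvalue — every laminate, every field with a strain zero, every member of the (F1)/X2C family —
has a POSITIVE heat price at EVERY real `q > 1`, so (F2) below `q = 2` too is a statement about
FAMILIES (`rate = 0`), never about one field. NOT here: the quantitative variance version (K53b
(R12), whose kernel proof uses the Lipschitz weight `λ₁^{q/2}`, `q ≥ 2`); any verdict change: L-λ(q)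
OPEN in the kernel ∀ real q > 1 (door (b) on paper: RULING (ζζ)); no 𝒦₀ row, no A12 count, no T_LD.
[ours]
FILING (prove seat g30, REQUEST #86): declarations byte-identical to the no-go seat's staged `TopEigHeatIsoTopLow.STAGING.lean` e1ffb3cbbaf8ca20; this line is the only addition.
-/

noncomputable section

open MeasureTheory Set Filter Topology
open scoped NNReal ENNReal

namespace Summit.NavierStokesRegularity.FunctionalMining

open Literature.Analysis.FunctionSpaces Literature.Analysis.FluidPDE

variable {d : Type*} [Fintype d] [DecidableEq d]

namespace TopEig

/-! ## § 0 The floor integrand without its prefactor (bookkeeping) -/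

section FloorIntegrand

variable [Nonempty d] {v : UnitAddTorus d → EuclideanSpace ℝ d} {q : ℝ}

/-- **The floor integrand `λ^{q−2} Σᵢ(∂ᵢλ)²` is integrable for every real `q > 1`** (for `q ≥ 2` the
tree knew this from the dominated limit; below `2` it is Fatou). [ours] -/
theorem FloorLow.integrable_floorIntegrand (hq : 1 < q) (hv : Torus.IsSmooth v)
    (hdv : Torus.IsDivFree v) :
    Integrable (fun x => torusStrainTopEig v x ^ (q - 2) *
      ∑ i, Torus.partialDeriv i (torusStrainTopEig v) x ^ 2) volume := by
  have h :=
    (FloorLow.integrable_floorIntegrand_and_integral_le hq hv hdv).1.const_mul (q * (q - 1))⁻¹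
  refine h.congr (Filter.Eventually.of_forall fun x => ?_)
  have hqq : q * (q - 1) ≠ 0 := mul_ne_zero (by linarith) (by linarith)
  show (q * (q - 1))⁻¹ * (q * (q - 1) * _) = _
  rw [← mul_assoc, inv_mul_cancel₀ hqq, one_mul]

end FloorIntegrand

/-! ## § 1 ISO-TOP for every real `q > 1` -/

section IsoTopLow

open StrainL4

variable {v : UnitAddTorus d → EuclideanSpace ℝ d} {q : ℝ}

/-- **Exactness at ANY real `q > 1` freezes the top eigenvalue gradient:** if
`heatDissipation Φ_q v ≤ 0` (smooth divergence-free `v`, `card d = 3`), then `∇λ₁ = 0` a.e. — the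
non-negative integrable floor integrand (K57a) has integral `≤ 0`, so it vanishes a.e.; at a
Rademacher point with `λ₁ > 0` all partials vanish, and a zero of `λ₁ ≥ 0` is a global minimum
(Fermat, K53ʼs `IsoTop.torusFderiv_eq_zero_of_forall_le`). [ours] -/
theorem gradient_topEig_eq_zero_ae_of_one_lt (hd : Fintype.card d = 3) (hq : 1 < q)
    (hv : Torus.IsSmooth v) (hdv : Torus.IsDivFree v)
    (hT : heatDissipation (torusTopEigMoment q) v ≤ 0) :
    ∀ᵐ x ∂(volume : Measure (UnitAddTorus d)), Torus.gradient (torusStrainTopEig v) x = 0 := by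
  haveI : Nonempty d := Fintype.card_pos_iff.mp (by omega)
  set L := torusStrainTopEig v with hL
  have hLnn : ∀ y, 0 ≤ L y := fun y => by
    rw [hL, ← lam_strainFlat]; exact lam_strainFlat_nonneg hv hdv y
  obtain ⟨K, hK⟩ := exists_lipschitzWith_torusStrainTopEig hv
  obtain ⟨hgi, hgle⟩ := FloorLow.integrable_floorIntegrand_and_integral_le hq hv hdv
  have hqq : 0 < q * (q - 1) := mul_pos (by linarith) (by linarith)
  have hgnn : ∀ x, 0 ≤ q * (q - 1) * (L x ^ (q - 2) * ∑ i, Torus.partialDeriv i L x ^ 2) :=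
    fun x => mul_nonneg hqq.le
      (mul_nonneg (Real.rpow_nonneg (hLnn x) _) (Finset.sum_nonneg fun i _ => sq_nonneg _))
  have hI0 : ∫ x, q * (q - 1) * (L x ^ (q - 2) * ∑ i, Torus.partialDeriv i L x ^ 2) = 0 :=
    le_antisymm (hgle.trans hT) (integral_nonneg hgnn)
  have hae := (integral_eq_zero_iff_of_nonneg (fun x => hgnn x) hgi).1 hI0
  filter_upwards [hae, Torus.ae_differentiableAt_liftAt hK] with x hx hdiff
  have hfd : Torus.fderiv L x = 0 := by
    rcases eq_or_lt_of_le (hLnn x) with h0 | hpos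
    · exact IsoTop.torusFderiv_eq_zero_of_forall_le fun z => by rw [← h0]; exact hLnn z
    · refine IsoTop.clm_eq_zero_of_forall_single fun i => ?_
      rw [← partialDeriv_topEig_eq hdiff i]
      have hx' : q * (q - 1) * (L x ^ (q - 2) * ∑ j, Torus.partialDeriv j L x ^ 2) = 0 := hx
      have h1 : L x ^ (q - 2) * ∑ j, Torus.partialDeriv j L x ^ 2 = 0 :=
        (mul_eq_zero.1 hx').resolve_left hqq.ne'
      have h2 : ∑ j, Torus.partialDeriv j L x ^ 2 = 0 :=
        (mul_eq_zero.1 h1).resolve_left (Real.rpow_pos_of_pos hpos _).ne'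
      exact pow_eq_zero_iff (n := 2) (by norm_num) |>.1
        ((Finset.sum_eq_zero_iff_of_nonneg fun j _ => sq_nonneg (Torus.partialDeriv j L x)).1 h2 i
          (Finset.mem_univ i))
  rw [Torus.gradient_eq_toDual_symm_torusFderiv, hfd, map_zero]

/-- **ISO-TOP on the whole range.** On `T³` (`card d = 3`), a smooth divergence-free `v` with
`heatDissipation Φ_q v ≤ 0` for some real `q > 1` — in particular an EXACT (F2) witness at ANY
exponent of the node — has a CONSTANT top strain eigenvalue: `λ₁(S_v)(x) = λ₁(S_v)(y)` for all
`x, y`. Extends K53ʼs `torusStrainTopEig_eq_of_heatDissipation_nonpos` (`q ≥ 2`). [ours] -/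
theorem torusStrainTopEig_eq_of_heatDissipation_nonpos_of_one_lt (hd : Fintype.card d = 3)
    (hq : 1 < q) (hv : Torus.IsSmooth v) (hdv : Torus.IsDivFree v)
    (hT : heatDissipation (torusTopEigMoment q) v ≤ 0) (x y : UnitAddTorus d) :
    torusStrainTopEig v x = torusStrainTopEig v y := by
  haveI : Nonempty d := Fintype.card_pos_iff.mp (by omega)
  obtain ⟨K, hK⟩ := exists_lipschitzWith_torusStrainTopEig hv
  exact IsoTop.eq_of_gradient_eq_zero_ae hK
    (gradient_topEig_eq_zero_ae_of_one_lt hd hq hv hdv hT) x y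

/-- The value of a frozen top, from any exponent `q > 1`: `Φ_p(v) = λ₁(x₀)^p` for every `x₀` and
every real `p`. [ours] -/
theorem torusTopEigMoment_eq_rpow_of_heatDissipation_nonpos_of_one_lt (hd : Fintype.card d = 3)
    (hq : 1 < q) (hv : Torus.IsSmooth v) (hdv : Torus.IsDivFree v)
    (hT : heatDissipation (torusTopEigMoment q) v ≤ 0) (x₀ : UnitAddTorus d) (p : ℝ) :
    torusTopEigMoment p v = torusStrainTopEig v x₀ ^ p := by
  haveI : Nonempty d := Fintype.card_pos_iff.mp (by omega)
  have hnn : 0 ≤ torusStrainTopEig v x₀ := by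
    rw [← lam_strainFlat]; exact lam_strainFlat_nonneg hv hdv x₀
  have hconst : ∀ x, torusStrainTopEig v x = torusStrainTopEig v x₀ := fun x =>
    torusStrainTopEig_eq_of_heatDissipation_nonpos_of_one_lt hd hq hv hdv hT x x₀
  unfold torusTopEigMoment
  simp_rw [hconst, max_eq_left hnn]
  simp

/-- **Design rule (R11) on the whole range, contrapositive form: a non-constant top strain
eigenvalue costs at EVERY real `q > 1`.** [ours] -/
theorem heatDissipation_topEigMoment_pos_of_ne_of_one_lt (hd : Fintype.card d = 3) (hq : 1 < q)
    (hv : Torus.IsSmooth v) (hdv : Torus.IsDivFree v) {x y : UnitAddTorus d}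
    (hne : torusStrainTopEig v x ≠ torusStrainTopEig v y) :
    0 < heatDissipation (torusTopEigMoment q) v := by
  by_contra h
  exact hne (torusStrainTopEig_eq_of_heatDissipation_nonpos_of_one_lt hd hq hv hdv (not_lt.1 h) x y)

/-- **A strain with `λ₁ = 0` somewhere (e.g. a strain zero) and `Φ_q > 0` is never exact**, at any
real `q > 1`. [ours] -/
theorem heatDissipation_topEigMoment_pos_of_topEig_eq_zero_of_one_lt (hd : Fintype.card d = 3)
    (hq : 1 < q) (hv : Torus.IsSmooth v) (hdv : Torus.IsDivFree v) {x₀ : UnitAddTorus d}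
    (h0 : torusStrainTopEig v x₀ = 0) (hΦ : 0 < torusTopEigMoment q v) :
    0 < heatDissipation (torusTopEigMoment q) v := by
  by_contra h
  have hq0 : q ≠ 0 := by linarith
  have e := torusTopEigMoment_eq_rpow_of_heatDissipation_nonpos_of_one_lt hd hq hv hdv (not_lt.1 h)
    x₀ q
  rw [h0, Real.zero_rpow hq0] at e
  exact absurd e hΦ.ne'

end IsoTopLow

/-! ## § 2 On `T³`: exact at ONE exponent `q₀ > 1` ⇒ exact at EVERY exponent `q > 1` -/

section UniversalLow

open StrainL4

variable {v : UnitAddTorus (Fin 3) → EuclideanSpace ℝ (Fin 3)}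

/-- A frozen top that is exact at some `q₀ > 1` is exact at the exponent `2`: with `λ₁ ≡ m`,
Danskin on the frozen top (K53 `heatDissipation_topEigMoment_eq_of_const`) reads
`heatDissipation Φ_p v = −(p m^{p−1}) ∫μ` at every `p ≥ 1`; `m = 0` kills the price at `2`
termwise, and for `m > 0` exactness at `q₀` gives `∫μ ≥ 0`. [ours, bookkeeping] -/
theorem heatDissipation_two_nonpos_of_exact_of_one_lt {q₀ : ℝ} (hq₀ : 1 < q₀)
    (hv : Torus.IsSmooth v) (hdv : Torus.IsDivFree v)
    (hT₀ : heatDissipation (torusTopEigMoment q₀) v ≤ 0) :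
    heatDissipation (torusTopEigMoment 2) v ≤ 0 := by
  have hd : Fintype.card (Fin 3) = 3 := Fintype.card_fin 3
  set m : ℝ := torusStrainTopEig v 0 with hmdef
  have hm : ∀ x, torusStrainTopEig v x = m := fun x =>
    torusStrainTopEig_eq_of_heatDissipation_nonpos_of_one_lt hd hq₀ hv hdv hT₀ x 0
  have hmnn : 0 ≤ m := by
    rw [hmdef, ← lam_strainFlat]; exact lam_strainFlat_nonneg hv hdv 0
  have eq2 := heatDissipation_topEigMoment_eq_of_const (q := 2) (by norm_num) hv hdv hm
  have eq₀ := heatDissipation_topEigMoment_eq_of_const hq₀.le hv hdv hm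
  set I : ℝ := ∫ x, dirTopEig (strainFlat v x) (strainFlat (Torus.laplacian v) x) with hI
  rw [eq2]
  rcases eq_or_lt_of_le hmnn with h0 | hpos
  · rw [← h0]; norm_num
  · have hc₀ : 0 < q₀ * m ^ (q₀ - 1) := mul_pos (by linarith) (Real.rpow_pos_of_pos hpos _)
    have hIge : 0 ≤ I := by
      rw [eq₀] at hT₀
      by_contra hI'
      have : 0 < -(q₀ * m ^ (q₀ - 1)) * I := by nlinarith [not_le.1 hI']
      linarith
    have h2 : (0 : ℝ) ≤ 2 * m ^ ((2 : ℝ) - 1) := mul_nonneg (by norm_num) (Real.rpow_nonneg hmnn _)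
    nlinarith

/-- **EXACT ONCE ⇒ EXACT ALWAYS, from ANY exponent.** On `T³`, a smooth divergence-free `v` with
`heatDissipation Φ_{q₀} v ≤ 0` for ONE real `q₀ > 1` has `heatDissipation Φ_q v = 0` for EVERY real
`q > 1` (K53 § 4 needed `q₀ ≥ 2`). Sharpens K50 (R8) on the whole range: NO exponent `q₀ > 1` is an
isolated exact exponent — the exact-exponent set of a design is `∅` or all of `(1, ∞)`. [ours] -/
theorem heatDissipation_topEigMoment_eq_zero_of_exact_of_one_lt {q₀ : ℝ} (hq₀ : 1 < q₀)
    (hv : Torus.IsSmooth v) (hdv : Torus.IsDivFree v)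
    (hT₀ : heatDissipation (torusTopEigMoment q₀) v ≤ 0) {q : ℝ} (hq : 1 < q) :
    heatDissipation (torusTopEigMoment q) v = 0 :=
  heatDissipation_topEigMoment_eq_zero_of_exact (le_refl (2 : ℝ)) hv hdv
    (heatDissipation_two_nonpos_of_exact_of_one_lt hq₀ hv hdv hT₀) hq

/-- **Portrait, amplitude side, from ANY exponent (summary).** An exact (F2) witness on `T³` at a
real exponent `q₀ > 1` has: a constant top strain eigenvalue `λ₁ ≡ m ≥ 0`, `Φ_p(v) = m^p` for every
real `p`, and zero heat price `heatDissipation Φ_q v = 0` at every real `q > 1`. [ours] -/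
theorem exact_witness_isoTop_portrait_of_one_lt {q₀ : ℝ} (hq₀ : 1 < q₀) (hv : Torus.IsSmooth v)
    (hdv : Torus.IsDivFree v) (hT₀ : heatDissipation (torusTopEigMoment q₀) v ≤ 0) :
    ∃ m : ℝ, 0 ≤ m ∧ (∀ x, torusStrainTopEig v x = m) ∧ (∀ p : ℝ, torusTopEigMoment p v = m ^ p) ∧
      ∀ q : ℝ, 1 < q → heatDissipation (torusTopEigMoment q) v = 0 :=
  exact_witness_isoTop_portrait (le_refl (2 : ℝ)) hv hdv
    (heatDissipation_two_nonpos_of_exact_of_one_lt hq₀ hv hdv hT₀)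

end UniversalLow

end TopEig

end Summit.NavierStokesRegularity.FunctionalMining

end
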